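import Literature.Geometry.Symplectic.AlmostComplexStructure
import Literature.Geometry.Symplectic.JHolomorphicMap
import Literature.Geometry.Symplectic.PlusOneSpherePairProofs
import Literature.Topology.FourManifolds.ComplexProjectiveSpaceCohomology
import Literature.Geometry.Kaehler.ManifoldForms
import Mathlib.Topology.CompactOpen
import Mathlib.Topology.Homotopy.Basic
import HarnessLib

/-!
# Gromov compactness for `J`-holomorphic spheres in a fixed class, dichotomy form

Named fact (D-0014) requested by the crux chain of `GromovRecognitionRelEnd` (item
stmt-SmoothPoincare4-11009, line `cross-cap-laurent`, core stub `stub_biFoliationCore`; dossier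
`Summits/SmoothPoincare4/SmoothPoincare4/Cruxes/GromovRecognitionRelEnd/Lines/cross-cap-laurent-core-c3.md`
§4 "(F2+)"), over the two-chart vocabulary of `J`-holomorphic spheres of that chain (pairs
`u v : ℂ → X`, `v z = u z⁻¹`, `Literature.Geometry.Symplectic.IsJHolomorphic`; glued maps
`Literature.Topology.FourManifolds.ComplexProjectiveSpace 1 → X`; homology classes of spheres as
push-forwards of `ComplexProjectiveSpace.homologicalOrientationInt 1`'s fundamental class;
reparametrisations of `ℂℙ¹` by `Literature.Geometry.Symplectic.PlusOneSpherePair.projectiveMap` of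
linear automorphisms of `ℂ²`).

## What is printed

* M. Gromov, Invent. Math. 82 (1985), **1.5.B** (compactness for closed `J`-curves of bounded area:
  a subsequence converges to a cusp-curve); C. Hummel, *Gromov's compactness theorem for
  pseudo-holomorphic curves* (1997), Ch. V, Thm. 1.2.
* D. McDuff, D. Salamon, *J-holomorphic curves and symplectic topology*, 2nd ed. (2012),
  **Thm. 5.3.1** (Gromov compactness for spheres): *`(M, ω)` compact symplectic, `Jᵛ → J` in
  `𝒥_τ(M, ω)`, `uᵛ : S² → M` `Jᵛ`-holomorphic spheres with `sup E(uᵛ) < ∞`. Then `uᵛ` has a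
  subsequence which Gromov converges to a stable map `(u, z)` of genus zero*; Def. 5.2.1 (Gromov
  convergence: (Map) `uᵛ ∘ φᵛ_α → u_α` in `C^∞_loc(S² ∖ Z_α)`, (Energy), (Rescaling), (Nodal
  points)); **Def. 5.1.1** (stability: every constant ("ghost") component carries at least three
  special points); Thm. 5.2.2 (ii)/(iii): the limit stable map has the same total energy and
  *represents the same homology class* `Σ_α [u_α] = [uᵛ]`.
* C. Wendl, *Holomorphic Curves in Low Dimensions* (2018), §4.1 and Thm. 4.6 (dimension four).

## The form vendored here (dichotomy; energy bound = fixed homotopy class)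

`X` a compact 4-manifold, `JX` an almost complex structure tamed by a CLOSED smooth 2-form `ωX`
(then `E(u) = ∫ u^*ωX = ⟨[ωX], [u]⟩` is constant on a homotopy class), `(uₙ, vₙ)` `JX`-holomorphic
two-chart spheres with glued maps `Fₙ` all homotopic to a fixed `F₀`. After passing to a subsequence
`φ`, EITHER
(A) there are linear reparametrisations `A k` of `ℂℙ¹` and a `JX`-two-chart sphere `(u, v)` with
    glued map `F` such that `F_{φ k} ∘ [A k] → F` in `C(ℂℙ¹, X)` (compact-open topology = uniform
    convergence) — the limit stable tree has ONE vertex (a stable tree all of whose vertices but one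
    are ghosts is that vertex alone, Def. 5.1.1), and Gromov convergence with no nodal points is
    `C^∞`, in particular uniform, convergence of the reparametrised maps on all of `S²`;
OR
(B) the energy SPLITS: there are `m ≥ 2` NON-CONSTANT `JX`-two-chart spheres `B₁, …, Bₘ` (the
    non-constant vertices of the limit stable tree) whose glued maps' fundamental classes add up to
    that of the `Fₙ` in `H₂(X; ℤ)` (Thm. 5.2.2: the limit represents the same class; ghosts carry
    the zero class) and whose images attract the images of the `u_{φ k}` in the Hausdorff sense
    (every open neighbourhood of `⋃ⱼ im Bⱼ` eventually contains `im u_{φ k}`, and every point of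
    `⋃ⱼ im Bⱼ` is a limit of points of `im u_{φ k}`; the image of the stable map is the union of the
    images of its non-constant vertices, ghosts mapping to nodes on them).
Only these consequences of Gromov convergence are recorded (no bubble-tree vocabulary).
-- TODO(general form): varying `Jᵛ → J`, higher genus / marked points, and the full (Map),
-- (Rescaling), (Nodal points) clauses of Def. 5.2.1 are not recorded.
Nothing is asserted: users take `(h : gromovCompactness_spheres_dichotomy)`; SIZE XL (ε-regularity,
removal of singularities, bubbling analysis; McDuff–Salamon Ch. 4–5).

## References

* M. Gromov, *Pseudo holomorphic curves in symplectic manifolds*, Invent. Math. 82 (1985), 1.5.B.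
  [Gromov1985]
* D. McDuff, D. Salamon, *J-holomorphic curves and symplectic topology*, 2nd ed., AMS (2012),
  Def. 5.1.1, Def. 5.2.1, Thm. 5.2.2, Thm. 5.3.1, Thm. 4.6.1. [McDuffSalamon2012]
* C. Hummel, *Gromov's compactness theorem for pseudo-holomorphic curves*, Progress in Math. 151
  (1997), Ch. V. [Hummel1997]
* C. Wendl, *Holomorphic Curves in Low Dimensions*, LNM 2216 (2018), §4.1, Thm. 4.6. [Wendl2018]
-/

noncomputable section

open scoped Manifold ContDiff Topology
open Set Function Literature.Topology.FourManifolds Literature.Topology.FourManifolds.ComplexProjectiveSpace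
  Literature.Geometry.Kaehler Literature.AlgebraicTopology.SingularHomology

namespace Literature.Geometry.Symplectic

/-- **Gromov compactness for `J`-spheres in a fixed homotopy class, dichotomy form** (Gromov 1985,
1.5.B; McDuff–Salamon 2012, Thm. 5.3.1 with Def. 5.1.1 (stability) and Thm. 5.2.2 (same homology
class); Wendl 2018, Thm. 4.6). `X` compact, `JX` tamed by a closed smooth 2-form, `(uₙ, vₙ)`
`JX`-two-chart spheres whose glued maps `Fₙ : ℂℙ¹ → X` are homotopic to a fixed `F₀`. Then along a
subsequence `φ` EITHER (A) `F_{φ k} ∘ [A k] → F` uniformly for some linear reparametrisations `A k`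
and a `JX`-sphere `(u, v)` with glued map `F`, OR (B) there are `m ≥ 2` non-constant `JX`-spheres
whose glued fundamental classes add up to that of the `Fₙ` and whose images are the Hausdorff limit
of the images of the `u_{φ k}`. [cite: McDuffSalamon2012, Thm. 5.3.1 and Thm. 5.2.2] [cite: Gromov1985, 1.5.B] -/
def gromovCompactness_spheres_dichotomy : Prop :=
  ∀ (X : Type) [TopologicalSpace X] [T2Space X] [SecondCountableTopology X] [CompactSpace X]
    [ChartedSpace (EuclideanSpace ℝ (Fin 4)) X] [IsManifold (𝓡 4) ∞ X]
    (ωX : MForm (𝓡 4) X ℝ 2) (JX : AlmostComplexStructure (𝓡 4) ∞ X)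
    (us vs : ℕ → ℂ → X) (Fs : ℕ → C(ComplexProjectiveSpace 1, X)) (F₀ : C(ComplexProjectiveSpace 1, X)),
    IsSmoothForm ωX → IsClosedForm ωX → JX.IsTamedBy ωX →
    (∀ n, ContMDiff 𝓘(ℝ, ℂ) (𝓡 4) ∞ (us n) ∧ ContMDiff 𝓘(ℝ, ℂ) (𝓡 4) ∞ (vs n) ∧
      (∀ z : ℂ, z ≠ 0 → vs n z = us n z⁻¹) ∧
      IsJHolomorphic (𝓡 4) (fun y => JX y) (us n) ∧ IsJHolomorphic (𝓡 4) (fun y => JX y) (vs n) ∧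
      (∀ p, CoordNeZero 0 p → Fs n p = us n (affineCoordComplex 0 p 0)) ∧
      (∀ p, CoordNeZero 1 p → Fs n p = vs n (affineCoordComplex 1 p 0)) ∧
      (Fs n).Homotopic F₀) →
    ∃ φ : ℕ → ℕ, StrictMono φ ∧
     ((-- (A) convergence modulo reparametrisation, no energy loss
       ∃ (u v : ℂ → X) (F : C(ComplexProjectiveSpace 1, X))
         (A : ℕ → ((Fin 2 → ℂ) ≃ₗ[ℂ] (Fin 2 → ℂ))),
         ContMDiff 𝓘(ℝ, ℂ) (𝓡 4) ∞ u ∧ ContMDiff 𝓘(ℝ, ℂ) (𝓡 4) ∞ v ∧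
         (∀ z : ℂ, z ≠ 0 → v z = u z⁻¹) ∧
         IsJHolomorphic (𝓡 4) (fun y => JX y) u ∧ IsJHolomorphic (𝓡 4) (fun y => JX y) v ∧
         (∀ p, CoordNeZero 0 p → F p = u (affineCoordComplex 0 p 0)) ∧
         (∀ p, CoordNeZero 1 p → F p = v (affineCoordComplex 1 p 0)) ∧
         Filter.Tendsto (fun k => (Fs (φ k)).comp
           ⟨PlusOneSpherePair.projectiveMap (A k), PlusOneSpherePair.continuous_projectiveMap (A k)⟩)
           Filter.atTop (𝓝 F)) ∨
      (-- (B) the energy splits into `m ≥ 2` non-constant pieces representing the same class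
       ∃ (m : ℕ) (Bu Bv : Fin m → ℂ → X) (G : Fin m → C(ComplexProjectiveSpace 1, X)), 2 ≤ m ∧
         (∀ j, ContMDiff 𝓘(ℝ, ℂ) (𝓡 4) ∞ (Bu j) ∧ ContMDiff 𝓘(ℝ, ℂ) (𝓡 4) ∞ (Bv j) ∧
           (∀ z : ℂ, z ≠ 0 → Bv j z = Bu j z⁻¹) ∧
           IsJHolomorphic (𝓡 4) (fun y => JX y) (Bu j) ∧ IsJHolomorphic (𝓡 4) (fun y => JX y) (Bv j) ∧
           (∃ z, Bu j z ≠ Bu j 0) ∧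
           (∀ p, CoordNeZero 0 p → G j p = Bu j (affineCoordComplex 0 p 0)) ∧
           (∀ p, CoordNeZero 1 p → G j p = Bv j (affineCoordComplex 1 p 0))) ∧
         (∀ n, ∑ j, singularHomology.map ℤ ℤ (G j) (2 * 1)
             (ComplexProjectiveSpace.homologicalOrientationInt 1).fundamentalClass =
           singularHomology.map ℤ ℤ (Fs n) (2 * 1)
             (ComplexProjectiveSpace.homologicalOrientationInt 1).fundamentalClass) ∧
         (∀ O : Set X, IsOpen O → (⋃ j, (range (Bu j) ∪ {Bv j 0})) ⊆ O →
           ∀ᶠ k in Filter.atTop, range (us (φ k)) ∪ {vs (φ k) 0} ⊆ O) ∧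
         (∀ y ∈ ⋃ j, (range (Bu j) ∪ {Bv j 0}), ∀ O' : Set X, IsOpen O' → y ∈ O' →
           ∀ᶠ k in Filter.atTop, ((range (us (φ k)) ∪ {vs (φ k) 0}) ∩ O').Nonempty)))

end Literature.Geometry.Symplectic

end
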